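import Summits.Ventures.CertifiedManyBodySolver.Rows.ChainMarginalNodes
import Summits.Ventures.CertifiedManyBodySolver.Rows.SpinChainMPSNodes
import Summits.Ventures.CertifiedManyBodySolver.Transport.MPSPrimalHubbardChain

/-!
# Row predicate for the lane-B `relax = mps(N, D, A)` by-value node of the Hubbard chain (model `hubbard_jw(U)`, `t = 1`):
# the named node shape with rational slots and its solver-free EDGE to `LTIChainKSDNNode`

HONEST FRAMING: first certified bounds; not a superconductivity verdict; every number certified or labelled float.

WHAT THIS FILE IS (speedrun cell sr-mbsolver, LIT team lit-1 gen-8; LEAD D-19 r118 (c) default track "THEOREM B", fermion case).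
The tree proves the transport `Transport.ksdnClaim_of_mpsClaim` (`Transport/MPSPrimalHubbardChain.lean`): the finite statement a
lane-B `relax = mps(N, D, A)` certificate of the `hubbard_jw(U)` model certifies (FORMAT-ltisdp §1/§4.7, both readers accepting;
KSDN arXiv:2212.03014 §2.5 eq. (TNfullRelax5) with the fermionic reading of FORMAT §2) implies the `lti(N)` statement in
FORMAT-ltisdp form — the binder list of `LTIChainKSDNNode U n ν lo` (`Rows/ChainMarginalNodes.lean`). This file NAMES the `mps`
hypothesis shape as a ROW PREDICATE with rational slots,
  `MPSChainKSDNNode U n D A qb B ν lo`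
(window `{-1, …, n+1}` of `N = n + 3` sites = the problem file's `n`; bond dimension `D`; `A : Fin 4 → Matrix (Fin D) (Fin D) ℚ` =
`meta.A` VERBATIM in the site basis `s = n↑ + 2n↓` = the tree's `siteOcc`; `qb : Fin D → ℤ × ℤ` = `meta.bond_charges`; `B m` =
`max(1, meta.omega_entry_bounds[m])`; `ν` = the density row's value (total density of the first site); `lo` = `claimed.bound`):
its `ρ₃`-binders are VERBATIM those of `LTIChainKSDNNode U 0 ν lo` on the three-site window `{-1, 0, 1}` (PSD, trace, LTI,
`(N↑, N↓)` sectors, total density of site `-1`, real, `|·| ≤ 1`), its `ω`-binders are the rows E4L/E4R (with `ρ₃` read through the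
coordinates `chainWindowThreeEquiv : Fin 3 ≃ {-1,0,1}`, `i ↦ i − 1`, then as (first two sites, last site) / (first site, last two)),
E_mL/E_mR (`5 ≤ m ≤ N`), `ω_m ⪰ 0`, the sector zeros for the tags `q_eff(s_L) + (qb b − qb a) + q_eff(s_R)` (`cgTag hubbardQeff qb`,
FORMAT §4.3 with `q_eff = (2n↑−1, 2n↓−1)`), real entries, `|ω_m| ≤ B m` (`4 ≤ m ≤ N`), and its conclusion is the FORMAT bond objective
`lo ≤ Re tr(toSpin(U n_{-1↑}n_{-1↓} − Σ_σ (c†_{-1σ}c_{0σ} + c†_{0σ}c_{-1σ})) ρ₃)`.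

It proves the solver-free EDGE BY NAME `MPSChainKSDNNode.ltiChainKSDNNode : … → LTIChainKSDNNode U n ν lo` under the two RATIONAL
side conditions of the transport (charge covariance of the table `A` for `hubbardQeff`, FORMAT §4.12 "CHECKED at generation";
`frobSqQ (transferOpQ A ^ (m−2)) ≤ (B m)²`, `0 ≤ B m`, FORMAT §4.7), whence the M1 cells BY NAME through `LTIChainKSDNNode`'s cells:
`….m1EnergyLowerRow` (`ν = 1`), `….m1DopedEnergyLowerRow` (`ν = p/q`); and `….mono`.

NOTHING IS ASSERTED HERE: the node is a `def … : Prop` taken as a hypothesis; nodes are instantiated only under `Certificates/` from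
certificate files. No `sorry`, no new axiom, no named fact. [cite: KullEtAl2024, §2.3–2.5, §4.2, §6.2] [cite: ArakiMoriya2003, §4.1]
-/

noncomputable section

open Matrix Complex Filter Topology
open scoped ComplexOrder Kronecker BigOperators
open Literature.Probability.LatticeModels
open Literature.MathematicalPhysics.QuantumLattice
open Literature.MathematicalPhysics.QuantumLattice.HubbardWave0
open Literature.MathematicalPhysics.QuantumLattice.ThermodynamicLimit
open Literature.MathematicalPhysics.QuantumLattice.JordanWigner
open Literature.MathematicalPhysics.QuantumManyBody.StateRelaxation
open Literature.MathematicalPhysics.QuantumLattice.MPSCoarseGraining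
open Literature.Computability.QuantumComplexity (traceLeft traceRight)
open Summit.Ventures.CertifiedManyBodySolver.Transport

namespace Summit.Ventures.CertifiedManyBodySolver

/-! ## §A  Data: the `hubbard_jw` charge `q_eff` and the coordinates of the three-site window -/

section Data

/-- FORMAT-ltisdp's effective charge of the `hubbard_jw(U)` model form, `q_eff(s) = (2n↑(s) − 1, 2n↓(s) − 1)`, in the tree's site
basis `siteOcc` (`s = 0, 1, 2, 3` ↦ `∅, {↑}, {↓}, {↑,↓}`, i.e. `s = n↑ + 2n↓` as in FORMAT §4.1). [cite: KullEtAl2024, §3.3] -/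
def hubbardQeff (s : Fin 4) : ℤ × ℤ :=
  (2 * (if (0 : Fin 2) ∈ siteOcc s then 1 else 0 : ℤ) - 1, 2 * (if (1 : Fin 2) ∈ siteOcc s then 1 else 0 : ℤ) - 1)

/-- Unfolding `hubbardQeff`. -/
@[simp] theorem hubbardQeff_apply (s : Fin 4) : hubbardQeff s =
    (2 * (if (0 : Fin 2) ∈ siteOcc s then 1 else 0 : ℤ) - 1, 2 * (if (1 : Fin 2) ∈ siteOcc s then 1 else 0 : ℤ) - 1) := rfl

/-- **The coordinates of the three-site window**: `Fin 3 ≃ {-1, 0, 1}`, `i ↦ i − 1` (the problem file's sites `1, 2, 3` of `ρ₃` are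
the tree's sites `-1, 0, 1`). [folklore] -/
def chainWindowThreeEquiv : Fin 3 ≃ PolySite (chainWindow (-1) 1) where
  toFun i := PolySite.pt (fun _ => ((i : ℕ) : ℤ) - 1) (by
    rw [mem_chainWindow]
    have hi := i.2
    show -1 ≤ ((i : ℕ) : ℤ) - 1 ∧ ((i : ℕ) : ℤ) - 1 ≤ 1
    omega)
  invFun y := ⟨(ofLex y.1 0 + 1).toNat, by
    have h := mem_chainWindow.1 (PolySite.ofLex_mem y)
    have h1 : ((ofLex y.1 0 + 1).toNat : ℤ) = ofLex y.1 0 + 1 := Int.toNat_of_nonneg (by omega)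
    omega⟩
  left_inv i := Fin.ext (by
    show ((((i : ℕ) : ℤ) - 1) + 1).toNat = (i : ℕ)
    rw [sub_add_cancel, Int.toNat_natCast])
  right_inv y := polySite_eq_of_coord_eq (by
    have h := mem_chainWindow.1 (PolySite.ofLex_mem y)
    have h1 : ((ofLex y.1 0 + 1).toNat : ℤ) = ofLex y.1 0 + 1 := Int.toNat_of_nonneg (by omega)
    show (((ofLex y.1 0 + 1).toNat : ℕ) : ℤ) - 1 = ofLex y.1 0
    omega)

/-- The coordinates of `chainWindowThreeEquiv`: `i ↦ i − 1`. -/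
@[simp] theorem chainWindowThreeEquiv_coord (i : Fin 3) : ofLex (chainWindowThreeEquiv i).1 0 = ((i : ℕ) : ℤ) - 1 := rfl

end Data

/-! ## §B  The node predicate (window `{-1, …, n+1}` of `N = n + 3` sites, bond dimension `D`, model `hubbard_jw(U)`, `t = 1`) -/

section Nodes

/-- **Lane-B `relax = mps(N, D, A)` node, model `hubbard_jw(U)`, FORMAT-ltisdp form** (the `hclaim` of
`Transport.ksdnClaim_of_mpsClaim` at `t = 1` with rational data; FORMAT §1, §4.1, §4.7): for all variables
`ρ₃ : Op (PolySite {-1,0,1}) 4` and `ω m` (`4 ≤ m ≤ n + 3`, indexed `(s_L, (a,b), s_R)`), IF `ρ₃ ⪰ 0`, `tr ρ₃ = 1`, the LTI row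
`tr_{-1} ρ₃ = tr_{1} ρ₃`, the `(N↑, N↓)`-sector zeros, the total density of site `-1` equal to `ν`, real entries, `|ρ₃| ≤ 1`
(VERBATIM the binders of `LTIChainKSDNNode U 0 ν ·`); row E4L `tr_{s_L} ω₄ = (W₂ ⊗ 𝟙) ρ̃₃ (W₂ ⊗ 𝟙)ᴴ` and row E4R
`tr_{s_R} ω₄ = (𝟙 ⊗ W₂) ρ̃₃ (𝟙 ⊗ W₂)ᴴ` with `ρ̃₃ = ρ₃` read through `chainWindowThreeEquiv` (then as (first two sites, last site) /
(first site, last two)) and `W₂ = cgMap (castTensor A) 2`; rows E_mL / E_mR for `5 ≤ m ≤ n+3` (`L = leftMap`, `R = rightMap` of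
`castTensor A`); `ω_m ⪰ 0`, sector zeros for `cgTag hubbardQeff qb`, real entries, `|ω_m| ≤ B m` (`4 ≤ m ≤ n+3`) — THEN
`lo ≤ Re tr(toSpin(U n_{-1↑}n_{-1↓} − Σ_σ (c†_{-1σ}c_{0σ} + c†_{0σ}c_{-1σ})) ρ₃)` (bond objective, `U` on the LEFT site, `t = 1`).
By-name audit token: predicate NAME + `(U, n + 3 = the file's n, D, ν, lo)` + the tables `A` (= `meta.A`), `qb` (= `meta.bond_charges`),
`B m` (= `max(1, meta.omega_entry_bounds[m])`). [cite: KullEtAl2024, §2.5 eq. (TNfullRelax5), §4.2 eq. (relaxLocTIn), §6.2] -/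
def MPSChainKSDNNode (U : ℝ) (n D : ℕ) (A : Fin 4 → Matrix (Fin D) (Fin D) ℚ) (qb : Fin D → ℤ × ℤ) (B : ℕ → ℚ)
    (ν lo : ℚ) : Prop :=
  ∀ (ρ₃ : Op (PolySite (chainWindow (-1) 1)) 4)
    (ω : ℕ → Matrix (Fin 4 × ((Fin D × Fin D) × Fin 4)) (Fin 4 × ((Fin D × Fin D) × Fin 4)) ℂ),
    ρ₃.PosSemidef → ρ₃.trace = 1 →
    spinPartialTrace ((PolySite.affEmb 1 (unitVec 0) (chainWindow (-1) 0)).trans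
        (PolySite.incl affShiftSet_chainWindow_zero_subset_one)) ρ₃ =
      spinPartialTrace (PolySite.incl chainWindow_zero_subset_one) ρ₃ →
    (∀ σ : Fin 2, ∀ k k' : TensorIndex (PolySite (chainWindow (-1) 1)) 4,
      (∑ x, if σ ∈ siteOcc (k x) then 1 else 0 : ℕ) ≠ (∑ x, if σ ∈ siteOcc (k' x) then 1 else 0 : ℕ) → ρ₃ k k' = 0) →
    ((toSpin (nAt (-unitVec 0) neg_unitVec_mem_chainWindow_one 0 + nAt (-unitVec 0) neg_unitVec_mem_chainWindow_one 1) *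
        ρ₃).trace).re = ((ν : ℚ) : ℝ) →
    (∀ k k' : TensorIndex (PolySite (chainWindow (-1) 1)) 4, starRingEnd ℂ (ρ₃ k k') = ρ₃ k k') →
    (∀ k k' : TensorIndex (PolySite (chainWindow (-1) 1)) 4, ‖ρ₃ k k'‖ ≤ 1) →
    traceLeft (ω 4) = (cgMap (castTensor A) 2 ⊗ₖ (1 : Matrix (Fin 4) (Fin 4) ℂ)) *
        (ρ₃.submatrix (Equiv.arrowCongr chainWindowThreeEquiv (Equiv.refl (Fin 4)))
            (Equiv.arrowCongr chainWindowThreeEquiv (Equiv.refl (Fin 4)))).submatrix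
          ((Equiv.prodComm _ _).trans (Fin.snocEquiv fun _ => Fin 4))
          ((Equiv.prodComm _ _).trans (Fin.snocEquiv fun _ => Fin 4)) *
      (cgMap (castTensor A) 2 ⊗ₖ (1 : Matrix (Fin 4) (Fin 4) ℂ))ᴴ →
    traceRight ((ω 4).submatrix (Equiv.prodAssoc _ _ _) (Equiv.prodAssoc _ _ _)) =
      ((1 : Matrix (Fin 4) (Fin 4) ℂ) ⊗ₖ cgMap (castTensor A) 2) *
        (ρ₃.submatrix (Equiv.arrowCongr chainWindowThreeEquiv (Equiv.refl (Fin 4)))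
            (Equiv.arrowCongr chainWindowThreeEquiv (Equiv.refl (Fin 4)))).submatrix
          (Fin.consEquiv fun _ => Fin 4) (Fin.consEquiv fun _ => Fin 4) *
      ((1 : Matrix (Fin 4) (Fin 4) ℂ) ⊗ₖ cgMap (castTensor A) 2)ᴴ →
    (∀ k, k + 5 ≤ n + 3 → traceLeft (ω (k + 5)) =
      (leftMap (castTensor A) ⊗ₖ (1 : Matrix (Fin 4) (Fin 4) ℂ)) *
        (ω (k + 4)).submatrix (Equiv.prodAssoc _ _ _) (Equiv.prodAssoc _ _ _) *
      (leftMap (castTensor A) ⊗ₖ (1 : Matrix (Fin 4) (Fin 4) ℂ))ᴴ) →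
    (∀ k, k + 5 ≤ n + 3 → traceRight ((ω (k + 5)).submatrix (Equiv.prodAssoc _ _ _) (Equiv.prodAssoc _ _ _)) =
      ((1 : Matrix (Fin 4) (Fin 4) ℂ) ⊗ₖ rightMap (castTensor A)) * ω (k + 4) *
      ((1 : Matrix (Fin 4) (Fin 4) ℂ) ⊗ₖ rightMap (castTensor A))ᴴ) →
    (∀ k, k + 4 ≤ n + 3 → (ω (k + 4)).PosSemidef) →
    (∀ k, k + 4 ≤ n + 3 → ∀ i j, cgTag hubbardQeff qb i ≠ cgTag hubbardQeff qb j → ω (k + 4) i j = 0) →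
    (∀ k, k + 4 ≤ n + 3 → ∀ i j, starRingEnd ℂ (ω (k + 4) i j) = ω (k + 4) i j) →
    (∀ k, k + 4 ≤ n + 3 → ∀ i j, ‖ω (k + 4) i j‖ ≤ ((B (k + 4) : ℚ) : ℝ)) →
    ((lo : ℚ) : ℝ) ≤ ((toSpin ((U : ℂ) • (nAt (-unitVec 0) neg_unitVec_mem_chainWindow_one 0 *
          nAt (-unitVec 0) neg_unitVec_mem_chainWindow_one 1) +
        (-((1 : ℝ) : ℂ)) • ∑ σ : Fin 2,
          ((cAt (-unitVec 0) neg_unitVec_mem_chainWindow_one σ)ᴴ * cAt 0 zero_mem_chainWindow_one σ +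
            (cAt 0 zero_mem_chainWindow_one σ)ᴴ * cAt (-unitVec 0) neg_unitVec_mem_chainWindow_one σ)) * ρ₃).trace).re

end Nodes

/-! ## §C  The EDGE by name to `LTIChainKSDNNode`, and the M1 cells -/

section Cells

variable {U : ℝ} {n D : ℕ} {A : Fin 4 → Matrix (Fin D) (Fin D) ℚ} {qb : Fin D → ℤ × ℤ} {B : ℕ → ℚ} {ν lo lo' : ℚ} {p q : ℕ}

/-- A node survives a SMALLER slot `lo' ≤ lo`. -/
theorem MPSChainKSDNNode.mono (h : MPSChainKSDNNode U n D A qb B ν lo) (hlo : lo' ≤ lo) :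
    MPSChainKSDNNode U n D A qb B ν lo' :=
  fun ρ₃ ω h1 h2 h3 h4 h5 h6 h7 h8 h9 h10 h11 h12 h13 h14 h15 =>
    le_trans (by exact_mod_cast hlo) (h ρ₃ ω h1 h2 h3 h4 h5 h6 h7 h8 h9 h10 h11 h12 h13 h14 h15)

/-- Charge covariance of the cast tensor for `q_eff` from the RATIONAL check on the table `A`. -/
theorem mpsCovHubbard_of_rat (hAcov : ∀ s a b, A s a b ≠ 0 → qb b = qb a + hubbardQeff s) :
    ∀ s a b, castTensor A s a b ≠ 0 → qb b = qb a +
      (fun s : Fin 4 => ((2 * (if (0 : Fin 2) ∈ siteOcc s then 1 else 0 : ℤ) - 1,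
        2 * (if (1 : Fin 2) ∈ siteOcc s then 1 else 0 : ℤ) - 1) : ℤ × ℤ)) s :=
  fun s a b h => hAcov s a b ((castTensor_apply_ne_zero_iff A s a b).1 h)

/-- **THE EDGE BY NAME: an `mps(N, D, A)` certificate of the Hubbard chain is an `lti(N)` certificate** (`N = n + 3 ≥ 4`): under
the rational side conditions (charge covariance of `A` for `hubbardQeff`; `frobSqQ (transferOpQ A ^ (m−2)) ≤ (B m)²`, `0 ≤ B m`),
`MPSChainKSDNNode U n D A qb B ν lo → LTIChainKSDNNode U n ν lo`. Solver-free: KSDN's feasible point (`Transport.ksdnClaim_of_mpsClaim`).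
[cite: KullEtAl2024, §4.2] -/
theorem MPSChainKSDNNode.ltiChainKSDNNode (h : MPSChainKSDNNode U n D A qb B ν lo) (hn : 1 ≤ n)
    (hAcov : ∀ s a b, A s a b ≠ 0 → qb b = qb a + hubbardQeff s)
    (hB : ∀ k, k + 4 ≤ n + 3 → 0 ≤ B (k + 4) ∧ frobSqQ (transferOpQ A ^ (k + 2)) ≤ B (k + 4) ^ 2) :
    LTIChainKSDNNode U n ν lo :=
  ksdnClaim_of_mpsClaim 1 U n hn (castTensor A) (star_castTensor_apply A) qb (mpsCovHubbard_of_rat hAcov)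
    (fun m => ((B m : ℚ) : ℝ)) (mpsBounds_of_rat hB) chainWindowThreeEquiv chainWindowThreeEquiv_coord h

/-- **M1 cell BY NAME** (`ν = 1`, `U ≥ 0`): an `mps` node at half filling ⇒ `lo ≤ e₀(U)` (`M1EnergyLowerRow U lo`). -/
theorem MPSChainKSDNNode.m1EnergyLowerRow (h : MPSChainKSDNNode U n D A qb B 1 lo) (hn : 1 ≤ n) (hU : 0 ≤ U)
    (hAcov : ∀ s a b, A s a b ≠ 0 → qb b = qb a + hubbardQeff s)
    (hB : ∀ k, k + 4 ≤ n + 3 → 0 ≤ B (k + 4) ∧ frobSqQ (transferOpQ A ^ (k + 2)) ≤ B (k + 4) ^ 2) :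
    M1EnergyLowerRow U lo :=
  (h.ltiChainKSDNNode hn hAcov hB).m1EnergyLowerRow hU

/-- **M1 doped cell BY NAME** (total density of the first site `ν = p/q`, `1 ≤ q`, `p ≤ 2q`, `U ≥ 0`): `lo ≤ e₀(U, n = p/q)`
(`M1DopedEnergyLowerRow U p q lo`). -/
theorem MPSChainKSDNNode.m1DopedEnergyLowerRow (h : MPSChainKSDNNode U n D A qb B ν lo) (hn : 1 ≤ n) (hU : 0 ≤ U)
    (hq : 1 ≤ q) (hp : p ≤ 2 * q) (hν : ((ν : ℚ) : ℝ) = (p : ℝ) / (q : ℝ))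
    (hAcov : ∀ s a b, A s a b ≠ 0 → qb b = qb a + hubbardQeff s)
    (hB : ∀ k, k + 4 ≤ n + 3 → 0 ≤ B (k + 4) ∧ frobSqQ (transferOpQ A ^ (k + 2)) ≤ B (k + 4) ^ 2) :
    M1DopedEnergyLowerRow U p q lo :=
  (h.ltiChainKSDNNode hn hAcov hB).m1DopedEnergyLowerRow hU hq hp hν

end Cells

end Summit.Ventures.CertifiedManyBodySolver
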